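import Literature.Analysis.Fourier.LpMultiplier
import HarnessLib

/-!
# `Lᵖ` Fourier multipliers: the wave-packet obstruction (dispersion forces `p = 2`)

A one-parameter family of symbols `T_t ∈ M_p` with ONE constant for all `t ∈ ℝ` cannot
transport a dispersing wave packet unless `p = 2`: if Schwartz functions `f_s` satisfy
`T_t(D) f_s = f_{s+t}` (so that `‖f_a‖_p ≤ C‖f_b‖_p` for ALL `a, b`), `‖f_s‖_∞ → 0` as
`s → ∞` (dispersion) while `0 < m ≤ ‖f_s‖_2 ≤ m' < ∞` (conservation), then `p = 2`. Indeed
for `2 < p < ∞`, `‖f_0‖_pᵖ ≤ Cᵖ‖f_s‖_pᵖ ≤ Cᵖ‖f_s‖_∞^{p-2}‖f_s‖_2² → 0`; for `p = ∞` directly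
`‖f_0‖_∞ ≤ C‖f_s‖_∞ → 0`; for `1 ≤ p < 2`, `m² ≤ ‖f_s‖_2² ≤ ‖f_s‖_∞^{2-p}‖f_s‖_pᵖ ≤
‖f_s‖_∞^{2-p}(C‖f_0‖_p)ᵖ → 0`. This is the mechanism behind the lower bounds
`M_p(g e^{itφ}) ≥ c t^{|1/2-1/p|}` of [BrennerThomeeWahlbin1975, Ch. 1 Cor 5.1–5.3] (there via
Parseval, Hölder and the `M_p = M_{p'}` duality) and behind Brenner's theorem
[BrennerThomeeWahlbin1975, Ch. 5 Lemma 1.1]: for the solution operator `E(t)` of a symmetric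
hyperbolic system and `f_s = E(s)f` built on one smooth eigenvalue branch, `E(t)f_s = f_{s+t}`
exactly, and curvature of the branch makes `f_s` disperse (van der Corput). Arranged this way
the argument needs neither duality nor limits of multipliers, and treats `p < 2` and `p > 2`
alike.

## Contents

* `lintegral_rpow_enorm_le_essSup_rpow_mul` — `∫‖g‖ʳ ≤ ‖g‖_∞^{r-q} ∫‖g‖^q` (`0 ≤ q ≤ r`);
* `lintegral_rpow_enorm_eq_eLpNorm_rpow` — `∫‖g‖ᵖ = ‖g‖_pᵖ`;
* `eq_two_of_wavePacket` — the obstruction.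

## References

* [BrennerThomeeWahlbin1975] P. Brenner, V. Thomée, L. B. Wahlbin, LNM 434 (1975), Ch. 1 §5
  Cor 5.1–5.3 pp. 25–27; Ch. 5 §1 Lemma 1.1 pp. 92–93.
-/

noncomputable section

open MeasureTheory Filter FourierTransform
open scoped SchwartzMap ENNReal NNReal Topology

namespace Literature.Analysis.Fourier

/-! ### Interpolation between `L²`, `Lᵖ` and `L^∞` -/

section Interpolation

variable {α : Type*} {mα : MeasurableSpace α} {μ : Measure α} {E : Type*} [NormedAddCommGroup E]

/-- `∫ ‖g‖ʳ ≤ ‖g‖_∞^{r-q} ∫ ‖g‖^q` for `0 ≤ q ≤ r` (pointwise `‖g‖ʳ = ‖g‖^{r-q}‖g‖^q` and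
`‖g‖ ≤ ‖g‖_∞` a.e.). [folklore] -/
theorem lintegral_rpow_enorm_le_essSup_rpow_mul {g : α → E} (hg : AEStronglyMeasurable g μ)
    {q r : ℝ} (hq : 0 ≤ q) (hqr : q ≤ r) :
    ∫⁻ x, ‖g x‖ₑ ^ r ∂μ ≤ eLpNormEssSup g μ ^ (r - q) * ∫⁻ x, ‖g x‖ₑ ^ q ∂μ := by
  rw [← lintegral_const_mul'' _ (hg.enorm.pow_const q)]
  refine lintegral_mono_ae ?_
  filter_upwards [enorm_ae_le_eLpNormEssSup g μ] with x hx
  calc ‖g x‖ₑ ^ r = ‖g x‖ₑ ^ ((r - q) + q) := by rw [sub_add_cancel]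
    _ = ‖g x‖ₑ ^ (r - q) * ‖g x‖ₑ ^ q := ENNReal.rpow_add_of_nonneg _ _ (sub_nonneg.2 hqr) hq
    _ ≤ eLpNormEssSup g μ ^ (r - q) * ‖g x‖ₑ ^ q :=
        mul_le_mul_left (ENNReal.rpow_le_rpow hx (sub_nonneg.2 hqr)) _

/-- `∫ ‖g‖ᵖ = ‖g‖_pᵖ` for `0 < p < ∞`. [folklore] -/
theorem lintegral_rpow_enorm_eq_eLpNorm_rpow (g : α → E) {p : ℝ≥0∞} (hp0 : p ≠ 0)
    (hptop : p ≠ ∞) : ∫⁻ x, ‖g x‖ₑ ^ p.toReal ∂μ = eLpNorm g p μ ^ p.toReal := by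
  rw [lintegral_rpow_enorm_eq_rpow_eLpNorm' (ENNReal.toReal_pos hp0 hptop),
    eLpNorm_eq_eLpNorm' hp0 hptop]

/-- `∫ ‖g‖² = ‖g‖_2²`. [folklore] -/
theorem lintegral_sq_enorm_eq_eLpNorm_two_sq (g : α → E) :
    ∫⁻ x, ‖g x‖ₑ ^ (2 : ℝ) ∂μ = eLpNorm g 2 μ ^ (2 : ℝ) := by
  have h := lintegral_rpow_enorm_eq_eLpNorm_rpow g (μ := μ) (p := 2) two_ne_zero
    ENNReal.ofNat_ne_top
  rwa [ENNReal.toReal_ofNat] at h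

end Interpolation

/-! ### The obstruction -/

variable {V : Type*} [NormedAddCommGroup V] [InnerProductSpace ℝ V] [FiniteDimensional ℝ V]
  [MeasurableSpace V] [BorelSpace V] {ι : Type*} [Fintype ι]

/-- **Dispersing wave packets force `p = 2`.** Let `T_t` (`t ∈ ℝ`) be symbols in `M_p` with a
common constant `C`, `1 ≤ p ≤ ∞`, and `f_s` (`s ∈ ℝ`) Schwartz functions with
`T_t(D) f_s = f_{s+t}` for all `s, t`. If `‖f_s‖_∞ → 0` as `s → ∞` while
`0 < m ≤ ‖f_s‖_2 ≤ m' < ∞` for all `s`, then `p = 2`. (Proof in the module docstring: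
`‖f_a‖_p ≤ C‖f_b‖_p` for all `a, b`, and the interpolation inequalities between `L²`, `Lᵖ`,
`L^∞`.) [cite: BrennerThomeeWahlbin1975, Ch. 1 §5 Cor 5.1–5.3 (mechanism); Ch. 5 §1 Lemma 1.1] -/
theorem eq_two_of_wavePacket {p : ℝ≥0∞} (hp : 1 ≤ p) {C : ℝ≥0} {T : ℝ → V → Matrix ι ι ℂ}
    (hT : ∀ t, IsLpMultiplierWith p C (T t)) (f : ℝ → 𝓢(V, ι → ℂ))
    (hTf : ∀ s t, multiplierOp (T t) ⇑(f s) = ⇑(f (s + t)))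
    (hdecay : Tendsto (fun s => eLpNorm (⇑(f s)) ∞ volume) atTop (𝓝 0))
    {m m' : ℝ≥0∞} (hm : 0 < m) (hm' : m' < ∞)
    (hlow : ∀ s, m ≤ eLpNorm (⇑(f s)) 2 volume) (hupp : ∀ s, eLpNorm (⇑(f s)) 2 volume ≤ m') :
    p = 2 := by
  have hp0 : p ≠ 0 := (zero_lt_one.trans_le hp).ne'
  have hmeas : ∀ s, AEStronglyMeasurable (⇑(f s)) volume :=
    fun s => (f s).continuous.aestronglyMeasurable
  have hfin : eLpNorm (⇑(f 0)) p volume < ∞ := by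
    -- (bound first, then matched against the goal: elaborating `SchwartzMap.eLpNorm_lt_top`
    -- directly against an expected type makes the `volume` auto-param loop)
    have h := SchwartzMap.eLpNorm_lt_top (f 0) p
    exact h
  -- the transport bound `‖f_a‖_p ≤ C ‖f_b‖_p`
  have key : ∀ a b, eLpNorm (⇑(f a)) p volume ≤ C * eLpNorm (⇑(f b)) p volume := by
    intro a b
    have h := (hT (a - b)).bound (f b)
    rwa [hTf b (a - b), add_sub_cancel] at h
  -- `f 0` is not a.e. zero
  have hf0 : ¬ (⇑(f 0) =ᵐ[volume] 0) := by
    intro h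
    have h2 : eLpNorm (⇑(f 0)) 2 volume = 0 := by rw [eLpNorm_congr_ae h, eLpNorm_zero]
    have h3 := hlow 0
    rw [h2, nonpos_iff_eq_zero] at h3
    exact hm.ne' h3
  have hnorm0 : ∀ q : ℝ≥0∞, q ≠ 0 → eLpNorm (⇑(f 0)) q volume ≠ 0 := fun q hq h =>
    hf0 ((eLpNorm_eq_zero_iff (hmeas 0) hq).1 h)
  by_contra hp2
  rcases lt_or_gt_of_ne hp2 with hlt | hgt
  · -- case `1 ≤ p < 2`
    have hptop : p ≠ ∞ := ne_top_of_lt hlt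
    set P := p.toReal with hP
    have hP1 : 1 ≤ P := by
      have h := ENNReal.toReal_mono hptop hp
      simpa using h
    have hP2 : P < 2 := by
      have h := (ENNReal.toReal_lt_toReal hptop ENNReal.ofNat_ne_top).2 hlt
      simpa using h
    have hP0 : 0 < P := one_pos.trans_le hP1
    have hK : ((C : ℝ≥0∞) * eLpNorm (⇑(f 0)) p volume) ^ P ≠ ∞ :=
      ENNReal.rpow_ne_top_of_nonneg hP0.le (ENNReal.mul_ne_top ENNReal.coe_ne_top hfin.ne)
    have hbound : ∀ s, m ^ (2 : ℝ) ≤ eLpNorm (⇑(f s)) ∞ volume ^ (2 - P) *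
        ((C : ℝ≥0∞) * eLpNorm (⇑(f 0)) p volume) ^ P := by
      intro s
      calc m ^ (2 : ℝ) ≤ eLpNorm (⇑(f s)) 2 volume ^ (2 : ℝ) :=
            ENNReal.rpow_le_rpow (hlow s) zero_le_two
        _ = ∫⁻ x, ‖f s x‖ₑ ^ (2 : ℝ) := (lintegral_sq_enorm_eq_eLpNorm_two_sq _).symm
        _ ≤ eLpNormEssSup (⇑(f s)) volume ^ (2 - P) * ∫⁻ x, ‖f s x‖ₑ ^ P :=
            lintegral_rpow_enorm_le_essSup_rpow_mul (hmeas s) hP0.le hP2.le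
        _ = eLpNorm (⇑(f s)) ∞ volume ^ (2 - P) * eLpNorm (⇑(f s)) p volume ^ P := by
            rw [eLpNorm_exponent_top, hP, lintegral_rpow_enorm_eq_eLpNorm_rpow _ hp0 hptop]
        _ ≤ eLpNorm (⇑(f s)) ∞ volume ^ (2 - P) *
            ((C : ℝ≥0∞) * eLpNorm (⇑(f 0)) p volume) ^ P :=
            mul_le_mul_right (ENNReal.rpow_le_rpow (key s 0) hP0.le) _
    -- the right-hand side tends to `0`
    have htend : Tendsto (fun s => eLpNorm (⇑(f s)) ∞ volume ^ (2 - P) *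
        ((C : ℝ≥0∞) * eLpNorm (⇑(f 0)) p volume) ^ P) atTop (𝓝 0) := by
      have h1 : Tendsto (fun s => eLpNorm (⇑(f s)) ∞ volume ^ (2 - P)) atTop (𝓝 0) := by
        have h := ((ENNReal.continuous_rpow_const (y := 2 - P)).tendsto 0).comp hdecay
        rwa [ENNReal.zero_rpow_of_pos (by linarith)] at h
      have h := ENNReal.Tendsto.mul_const h1 (Or.inr hK)
      rwa [zero_mul] at h
    have hle : m ^ (2 : ℝ) ≤ 0 := ge_of_tendsto' htend hbound
    have h0 : m ^ (2 : ℝ) = 0 := le_antisymm hle zero_le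
    rw [ENNReal.rpow_eq_zero_iff] at h0
    rcases h0 with ⟨h0, -⟩ | ⟨-, h2⟩
    · exact hm.ne' h0
    · linarith
  · -- case `2 < p`
    rcases eq_or_ne p ∞ with hptop | hptop
    · -- `p = ∞`
      subst hptop
      have htend : Tendsto (fun s => (C : ℝ≥0∞) * eLpNorm (⇑(f s)) ∞ volume) atTop (𝓝 0) := by
        have h := ENNReal.Tendsto.const_mul (a := (C : ℝ≥0∞)) hdecay (Or.inr ENNReal.coe_ne_top)
        rwa [mul_zero] at h
      have hle : eLpNorm (⇑(f 0)) ∞ volume ≤ 0 := ge_of_tendsto' htend fun s => key 0 s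
      exact hnorm0 ∞ ENNReal.top_ne_zero (le_antisymm hle zero_le)
    · -- `2 < p < ∞`
      set P := p.toReal with hP
      have hP2 : 2 < P := by
        have h := (ENNReal.toReal_lt_toReal ENNReal.ofNat_ne_top hptop).2 hgt
        simpa using h
      have hP0 : 0 < P := by linarith
      have hm'2 : m' ^ (2 : ℝ) ≠ ∞ := ENNReal.rpow_ne_top_of_nonneg zero_le_two hm'.ne
      have hbound : ∀ s, eLpNorm (⇑(f 0)) p volume ≤
          C * (eLpNorm (⇑(f s)) ∞ volume ^ (P - 2) * m' ^ (2 : ℝ)) ^ (1 / P) := by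
        intro s
        refine (key 0 s).trans (mul_le_mul_right ?_ _)
        have h1 : eLpNorm (⇑(f s)) p volume = (∫⁻ x, ‖f s x‖ₑ ^ P) ^ (1 / P) := by
          rw [hP]
          exact eLpNorm_eq_lintegral_rpow_enorm_toReal hp0 hptop
        rw [h1]
        refine ENNReal.rpow_le_rpow ?_ (one_div_nonneg.2 hP0.le)
        calc ∫⁻ x, ‖f s x‖ₑ ^ P
            ≤ eLpNormEssSup (⇑(f s)) volume ^ (P - 2) * ∫⁻ x, ‖f s x‖ₑ ^ (2 : ℝ) :=
              lintegral_rpow_enorm_le_essSup_rpow_mul (hmeas s) zero_le_two hP2.le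
          _ = eLpNorm (⇑(f s)) ∞ volume ^ (P - 2) * eLpNorm (⇑(f s)) 2 volume ^ (2 : ℝ) := by
              rw [eLpNorm_exponent_top, lintegral_sq_enorm_eq_eLpNorm_two_sq]
          _ ≤ eLpNorm (⇑(f s)) ∞ volume ^ (P - 2) * m' ^ (2 : ℝ) :=
              mul_le_mul_right (ENNReal.rpow_le_rpow (hupp s) zero_le_two) _
      have htend : Tendsto (fun s => (C : ℝ≥0∞) *
          (eLpNorm (⇑(f s)) ∞ volume ^ (P - 2) * m' ^ (2 : ℝ)) ^ (1 / P)) atTop (𝓝 0) := by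
        have h1 : Tendsto (fun s => eLpNorm (⇑(f s)) ∞ volume ^ (P - 2)) atTop (𝓝 0) := by
          have h := ((ENNReal.continuous_rpow_const (y := P - 2)).tendsto 0).comp hdecay
          rwa [ENNReal.zero_rpow_of_pos (by linarith)] at h
        have h2 : Tendsto (fun s => eLpNorm (⇑(f s)) ∞ volume ^ (P - 2) * m' ^ (2 : ℝ)) atTop
            (𝓝 0) := by
          have h := ENNReal.Tendsto.mul_const h1 (Or.inr hm'2)
          rwa [zero_mul] at h
        have h3 : Tendsto (fun s => (eLpNorm (⇑(f s)) ∞ volume ^ (P - 2) * m' ^ (2 : ℝ)) ^ (1 / P))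
            atTop (𝓝 0) := by
          have h := ((ENNReal.continuous_rpow_const (y := 1 / P)).tendsto 0).comp h2
          rwa [ENNReal.zero_rpow_of_pos (one_div_pos.2 hP0)] at h
        have h := ENNReal.Tendsto.const_mul (a := (C : ℝ≥0∞)) h3 (Or.inr ENNReal.coe_ne_top)
        rwa [mul_zero] at h
      have hle : eLpNorm (⇑(f 0)) p volume ≤ 0 := ge_of_tendsto' htend hbound
      exact hnorm0 p hp0 (le_antisymm hle zero_le)

end Literature.Analysis.Fourier

end
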